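/-
Copyright (c) 2026 the pub-hodgecm-mathlib formalisation cell (harness21).  Prover seat hodgecm-mathlib-A-p12 (g24), 2026-09-02.  «S3-ram» (LEAD F0P3a-plan (g13); owner p06 (g15);
(Cnt2′) chair F0P3a-p07 (g14)): the W-SIDE PACK of the (α₂) TYPE-(2) line — ★ (B-i)∕(B-ii) read in the lattice currency of the (Cnt2′) axis census.  `--supports stmt-HodgeConjecture-24833`.
-/
import Literature.NumberTheory.Rogawski1990.DepthZeroKappaTransferTypeTwoRamifiedShellClassLawScalar   -- ★ p847932 (this seat): ⊇ ★ (B-i) II∕IV, ★ (B-ii) 1–2f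
import Literature.NumberTheory.Automorphic.UnitaryLatticeTreeFixedCosetStrataDictionary
import Literature.NumberTheory.Automorphic.UnitaryLatticeTreeApartment
import Literature.NumberTheory.Automorphic.HermitianLatticeTreeTransitiveRamifiedFlags
import Literature.NumberTheory.Automorphic.UnitaryTwoVertexStabilizerBruhatRamified
import Literature.NumberTheory.Rogawski1990.DepthZeroKappaTransferTypeTwoRamifiedDepthBallsOdd
import HarnessLib

/-!
# The W-side pack: `U₂(L⁺_v) ⧸ K⁰`-coset counts of ★ (B-i)∕(B-ii) as fixed self-dual lattice counts of `W = L_w²` (Kottwitz 1986 §3; Rogawski 1990 §4.9; Bruhat–Tits 1972 §10)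

Topic `NumberTheory/Rogawski1990`; namespace `Literature.NumberTheory.Automorphic.UnitaryGroup`.  THEOREMS ONLY; kernel lane `--supports stmt-HodgeConjecture-24833`; cell
`pub/hodgecm-mathlib` (D-0151), crux H413, count-neutral; seat A-p12 (g24).  HONEST LABEL: HC_CM is proved only modulo the 2 remaining named inputs (hLiu418 24832, h413 24833).

THE MATHEMATICS.  The (Cnt2′) rows `stub_T2G_{zero,pm}_{even,odd}` reduce (★ p847724 `…LatticeCurrency`, ★ p847852 `UnitaryLatticeTreeAxisCountTransport` ED. 2) to W-SIDE COUNTS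
`#{B ⊂ L_w² ∣ SD σ_w ϖ J B ∧ Γ·B = B ∧ P₂ B}` (`Γ = E₂γ₂ ∈ U(σ_w, J)`, rank-`N` lattice currency `UnitaryLatticeTree.IsSelfDualLattice`).  ★ (B-i)∕(B-ii) count the same
families as `K⁰`-COSETS `{hK⁰ : P(E₂(h⁻¹γ₂h))}` of `U₂(L⁺_v)`.  (§1) Coset counts transport along a coset-compatible bijection between two groups (`Quotient.congr`), and the
`∃ u`-form of a coset family equals its `fixedBy ∕ q.out`-form when `P` forces integrality and is `K_U`-conjugation stable.  (§2) The root `𝒪_w²` is self-dual for `J`, and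
`U(σ_w, J)` is TRANSITIVE on rank-`N`-currency self-dual lattices of `L_w²` — from ★ (hA) (rank-2 `ValuativeRel` currency) through the group-level statement `u⁻¹g ∈ GL₂(𝒪_w)`
(★ `span_range_transpose_eq_iff`, ★ `mapGL_stdLattice_eq_iff_mem_glInt`), so no lattice is moved across the `Valued ∕ ValuativeRel` currencies.  (§3) Hence, through
`E₂ : U₂(L⁺_v) ≅ U` and ★ `ncard_fixedBy_quotient_sep_eq_ncard_selfDual_fixed_sep`: **`#{hK⁰ : P(E₂(h⁻¹γ₂h))} = #{B ∣ SD, ΓB = B, Q B}`** whenever `P(u⁻¹Γu) ⟺ Q(u𝒪_w²)`.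
(§4) With `Q = LEV(ϖ) ∧ LEV(ϖ²)` (row `0` of ★ `ncard_selfDual_fixed_axis_zero_eq`) and `P` = the depth-`2` ball of ★ (B-i) (`|½trΓ − 1| ≤ |ϖ²|` for a 2-deep `Γ`): the W-side
ZERO counts **`(q+1)Σ_(k<n−1)q^k`** (even depth `2n`, `n ≥ 2`), **`0`** (depth `2`), **`m + 1 = 2Σ_(k<n)q^k`** (odd depth `2n+1`), `C′ = K♯` discharged by ★ `exists_subgroup_forall_mem_iff_sharp`.

## References
* [Kottwitz1986] R. Kottwitz, *Base change for unit elements of Hecke algebras*, Compositio Math. 60 (1986): §3.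
* [Rogawski1990] J. D. Rogawski, *Automorphic Representations of Unitary Groups in Three Variables* (1990): §4.9 pp. 54–56.
* [BruhatTits1972] F. Bruhat, J. Tits, *Groupes réductifs sur un corps local I*, Publ. Math. IHÉS 41 (1972): §10.
-/

set_option autoImplicit false

noncomputable section

open MeasureTheory Measure Set NumberField IsDedekindDomain Matrix ValuativeRel MulAction Finset Polynomial
open scoped ValuativeRel Matrix MatrixGroups WithZero

namespace Literature.NumberTheory.Automorphic.UnitaryGroup

open Literature.NumberTheory.Rogawski1990 Literature.NumberTheory.Automorphic Literature.NumberTheory.Automorphic.IntegralReduction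
open Literature.NumberTheory.Automorphic.UnitaryLatticeTree Literature.NumberTheory.Automorphic.HermitianLattice Literature.GroupTheory Literature.NumberTheory.GaloisRepresentations

/-! ## §1 Transport of coset counts between two groups, and the `∃ h`-form versus the `fixedBy`-form of a coset family -/

section Cosets
variable {G G' : Type*} [Group G] [Group G']

/-- **TRANSPORT OF COSET COUNTS BETWEEN TWO GROUPS.**  A bijection `Φ : G ≃ G′` with `h₁⁻¹h₂ ∈ K ⟺ Φ(h₁)⁻¹Φ(h₂) ∈ K′` descends to `G ⧸ K ≃ G′ ⧸ K′`; if `B ∘ Φ = A` on representatives it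
maps `{hK : A h}` onto `{h′K′ : B h′}` (★ `natCard_setOf_exists_mk_eq_of_equiv` is the case `G = G′`). [cite: LabesseLanglands1979, §2 p. 8] [cite: Kottwitz1988, §2] -/
theorem natCard_setOf_exists_mk_eq_of_equiv₂ (K : Subgroup G) (K' : Subgroup G') (Φ : G ≃ G') (hΦ : ∀ h₁ h₂ : G, h₁⁻¹ * h₂ ∈ K ↔ (Φ h₁)⁻¹ * Φ h₂ ∈ K')
    (A : G → Prop) (B : G' → Prop) (hAB : ∀ h, B (Φ h) ↔ A h) :
    Nat.card {x : G ⧸ K | ∃ h : G, x = (h : G ⧸ K) ∧ A h} = Nat.card {x : G' ⧸ K' | ∃ h : G', x = (h : G' ⧸ K') ∧ B h} := by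
  set e : G ⧸ K ≃ G' ⧸ K' := Quotient.congr (ra := QuotientGroup.leftRel K) (rb := QuotientGroup.leftRel K') Φ
    (fun a b => by rw [QuotientGroup.leftRel_apply, QuotientGroup.leftRel_apply]; exact hΦ a b) with he
  have hemk : ∀ h : G, e (h : G ⧸ K) = ((Φ h : G') : G' ⧸ K') := fun h => rfl
  refine Nat.card_congr (e.subtypeEquiv fun x => ?_)
  simp only [Set.mem_setOf_eq]
  constructor
  · rintro ⟨h, rfl, hA⟩
    exact ⟨Φ h, hemk h, (hAB h).2 hA⟩
  · rintro ⟨h', hx, hB⟩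
    obtain ⟨a, rfl⟩ := QuotientGroup.mk_surjective x
    rw [hemk, QuotientGroup.eq] at hx
    refine ⟨Φ.symm h', ?_, (hAB _).1 (by rw [Φ.apply_symm_apply]; exact hB)⟩
    rw [QuotientGroup.eq, hΦ, Φ.apply_symm_apply]
    exact hx
end Cosets

section FixedForm
variable {K : Type*} [Field K] [Valued K ℤᵐ⁰] [ValuativeRel K] [(Valued.v : Valuation K ℤᵐ⁰).Compatible] {N : ℕ}

/-- **THE `∃ u`-FORM IS THE `fixedBy`-FORM.**  For `γ ∈ U = U(σ, H)` with `|det γ| = 1` and a predicate `P` on `N × N` matrices which forces integrality and is stable under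
conjugation by `K_U = U ∩ GL_N(𝒪)`: `{uK_U : P(u⁻¹γu)} = {q ∈ Fix_γ(U ⧸ K_U) : P(q.out⁻¹ γ q.out)}` (the coset family in the `∃ u, x = uK_U ∧ P` spelling of ★ FILE C ∕ (B-i) ∕ (B-ii) versus
the `q.out` spelling of ★ `ncard_fixedBy_quotient_sep_eq_ncard_selfDual_fixed_sep`). [cite: Kottwitz1986, §3] [cite: Rogawski1990, §4.9 p. 54] -/
theorem setOf_exists_mk_eq_setOf_fixedBy (σ : K →+* K) (H : Matrix (Fin N) (Fin N) K) (γ : ↥(unitaryGroupOfForm σ H))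
    (hdet : Valued.v (((γ : ↥(unitaryGroupOfForm σ H)) : GL (Fin N) K) : Matrix (Fin N) (Fin N) K).det = 1)
    (P : Matrix (Fin N) (Fin N) K → Prop) (hPint : ∀ Y, P Y → ∀ a b, Valued.v (Y a b) ≤ 1)
    (hPconj : ∀ k : GL (Fin N) K, k ∈ glInt N K → k ∈ unitaryGroupOfForm σ H → ∀ Y : Matrix (Fin N) (Fin N) K, P Y →
      P (((k⁻¹ : GL (Fin N) K) : Matrix (Fin N) (Fin N) K) * Y * (k : Matrix (Fin N) (Fin N) K))) :
    {x : ↥(unitaryGroupOfForm σ H) ⧸ (glInt N K).subgroupOf (unitaryGroupOfForm σ H) |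
        ∃ u : ↥(unitaryGroupOfForm σ H), x = (u : ↥(unitaryGroupOfForm σ H) ⧸ (glInt N K).subgroupOf (unitaryGroupOfForm σ H)) ∧
          P (((u⁻¹ * γ * u : ↥(unitaryGroupOfForm σ H)) : GL (Fin N) K) : Matrix (Fin N) (Fin N) K)} =
      {q : ↥(unitaryGroupOfForm σ H) ⧸ (glInt N K).subgroupOf (unitaryGroupOfForm σ H) |
        q ∈ MulAction.fixedBy (↥(unitaryGroupOfForm σ H) ⧸ (glInt N K).subgroupOf (unitaryGroupOfForm σ H)) γ ∧
          P (((q.out⁻¹ * γ * q.out : ↥(unitaryGroupOfForm σ H)) : GL (Fin N) K) : Matrix (Fin N) (Fin N) K)} := by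
  ext q
  simp only [Set.mem_setOf_eq]
  constructor
  · rintro ⟨u, rfl, hP⟩
    obtain ⟨k, hk⟩ := QuotientGroup.mk_out_eq_mul ((glInt N K).subgroupOf (unitaryGroupOfForm σ H)) u
    have hkint : ((k : ↥(unitaryGroupOfForm σ H)) : GL (Fin N) K) ∈ glInt N K := (Subgroup.mem_subgroupOf).1 k.2
    -- `u⁻¹γu ∈ GL_N(𝒪)`: integral entries (from `P`) and unit determinant
    have hmem : ((u⁻¹ * γ * u : ↥(unitaryGroupOfForm σ H)) : GL (Fin N) K) ∈ glInt N K := by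
      rw [HermitianLatticeTree.mem_glInt_iff_forall_v_le_one_and_v_det_eq_one]
      refine ⟨hPint _ hP, ?_⟩
      rw [Subgroup.coe_mul, Subgroup.coe_mul, Subgroup.coe_inv, Units.val_mul, Units.val_mul, Matrix.det_mul, Matrix.det_mul, map_mul, map_mul, hdet, mul_one,
        ← map_mul, ← Matrix.det_mul, ← Units.val_mul, inv_mul_cancel, Units.val_one, Matrix.det_one, map_one]
    refine ⟨(mem_fixedBy_quotient_mk_iff ((glInt N K).subgroupOf (unitaryGroupOfForm σ H)) γ u).2 ((Subgroup.mem_subgroupOf).2 hmem), ?_⟩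
    rw [hk, _root_.mul_inv_rev, show (k : ↥(unitaryGroupOfForm σ H))⁻¹ * u⁻¹ * γ * (u * k) = (k : ↥(unitaryGroupOfForm σ H))⁻¹ * (u⁻¹ * γ * u) * k by group,
      Subgroup.coe_mul, Subgroup.coe_mul, Subgroup.coe_inv, Units.val_mul, Units.val_mul]
    exact hPconj _ hkint (k : ↥(unitaryGroupOfForm σ H)).2 _ hP
  · rintro ⟨-, hP⟩
    exact ⟨q.out, (QuotientGroup.out_eq' q).symm, hP⟩
end FixedForm

/-! ## §2 Rank `2`: `U(σ_w, J)` is transitive on the self-dual lattices of the rank-`N` currency (★ (hA), across the `Valued` ∕ `ValuativeRel` lattice currencies) -/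

section RankTwo
variable (L : Type) [Field L] [NumberField L] [IsCMField L] (v : HeightOneSpectrum (𝓞 ↥(maximalRealSubfield L)))
  (w : PlacesOver L v) (hw : IsCMField.complexConj L • w.1 = w.1)

omit [IsCMField L] in
/-- **THE ROOT `𝒪_w²` IS SELF-DUAL for `J = antidiag(1,1)`** (rank-`N` currency `UnitaryLatticeTree.IsSelfDualLattice`, any scale `|ϖ′| ≤ 1`). [cite: Jacobowitz1962, §7] -/
theorem isSelfDualLattice_stdLattice_antidiag_two (σ : (w.1.adicCompletion L) →+* (w.1.adicCompletion L)) {ϖ' : (w.1.adicCompletion L)} (hϖ' : Valued.v ϖ' ≤ 1) :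
    UnitaryLatticeTree.IsSelfDualLattice σ ϖ' (!![(0 : (w.1.adicCompletion L)), 1; 1, 0]) (stdLattice (w.1.adicCompletion L) 2) := by
  have hJJ : (!![(0 : (w.1.adicCompletion L)), 1; 1, 0] : Matrix (Fin 2) (Fin 2) (w.1.adicCompletion L)) * !![(0 : (w.1.adicCompletion L)), 1; 1, 0] = 1 := by
    ext i j; fin_cases i <;> fin_cases j <;> simp
  have hinv : (!![(0 : (w.1.adicCompletion L)), 1; 1, 0] : Matrix (Fin 2) (Fin 2) (w.1.adicCompletion L))⁻¹ = !![(0 : (w.1.adicCompletion L)), 1; 1, 0] :=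
    Matrix.inv_eq_left_inv hJJ
  refine isSelfDualLattice_stdLattice (fun i j => ?_) (fun i j => ?_) ?_ hϖ'
  · fin_cases i <;> fin_cases j <;> simp
  · rw [hinv]; fin_cases i <;> fin_cases j <;> simp
  · rw [Matrix.det_fin_two]; simp

include hw in
/-- **`U(σ_w, J)` IS TRANSITIVE ON SELF-DUAL LATTICES, RANK 2, rank-`N` currency** at a tame-ramified place: every `B` with `UnitaryLatticeTree.IsSelfDualLattice σ_w ϖ′ J B` is
`u·𝒪_w²` for some `u ∈ U(σ_w, J)`.  PROOF: `B = g·𝒪_w²` with unimodular `ᵗσ(g)Jg`, so `g·𝒪_w²` is self-dual in the rank-2 currency of ★ (hA)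
`forall_isSelfDualLattice_exists_latt_eq_of_ramified_antidiag`, which gives `u` with `u·𝒪_w² = g·𝒪_w²` there, i.e. `u⁻¹g ∈ GL₂(𝒪_w)` (★ `span_range_transpose_eq_iff`) — a statement
about the group only, so it crosses to the `Valued` lattice currency (★ `mapGL_stdLattice_eq_iff_mem_glInt`). [cite: Jacobowitz1962, §8] [cite: BruhatTits1972, §10] -/
theorem exists_unitary_mapGL_stdLattice_eq_of_isSelfDualLattice_two (he : v.asIdeal.ramificationIdx' w.1.asIdeal ≠ 1) (h2 : IsUnit (2 : 𝒪[(w.1.adicCompletion L)]))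
    {ϖ' : (w.1.adicCompletion L)} (B : Submodule (Valued.integer (w.1.adicCompletion L)) (Fin 2 → (w.1.adicCompletion L)))
    (hB : UnitaryLatticeTree.IsSelfDualLattice (galAdicCompletionMap (L := L) (IsCMField.complexConj L) hw) ϖ' (!![(0 : (w.1.adicCompletion L)), 1; 1, 0]) B) :
    ∃ u : ↥(unitaryGroupOfForm (galAdicCompletionMap (L := L) (IsCMField.complexConj L) hw) (!![(0 : (w.1.adicCompletion L)), 1; 1, 0] : Matrix (Fin 2) (Fin 2) (w.1.adicCompletion L))),
      B = UnitaryLatticeTree.mapGL ((u : ↥(unitaryGroupOfForm (galAdicCompletionMap (L := L) (IsCMField.complexConj L) hw) (!![(0 : (w.1.adicCompletion L)), 1; 1, 0] : Matrix (Fin 2) (Fin 2) (w.1.adicCompletion L)))) : GL (Fin 2) (w.1.adicCompletion L)) (stdLattice (w.1.adicCompletion L) 2) := by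
  obtain ⟨g, hBg, hGi, -, hGdet⟩ := hB
  have hsd : HermitianLatticeTree.IsSelfDualLattice (galAdicCompletionMap (L := L) (IsCMField.complexConj L) hw) (!![0, 1; 1, 0] : Matrix (Fin 2) (Fin 2) (w.1.adicCompletion L))
      (HermitianLatticeTree.latt ((g : GL (Fin 2) (w.1.adicCompletion L)) : Matrix (Fin 2) (Fin 2) (w.1.adicCompletion L))) := by
    refine ⟨g, rfl, fun i j => (v_le_one_iff_mem_integer _).1 (hGi i j), (v_eq_one_iff_valuation_eq_one _).1 ?_⟩
    rw [hGdet, pow_zero]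
  obtain ⟨u, hu⟩ := HermitianLatticeTree.forall_isSelfDualLattice_exists_latt_eq_of_ramified_antidiag (IsCMField.complexConj L) w (IsCMField.complexConj_ne_one L) hw he h2 _ hsd
  have hk : ((u : GL (Fin 2) (w.1.adicCompletion L)))⁻¹ * g ∈ glInt 2 (w.1.adicCompletion L) :=
    (span_range_transpose_eq_iff (u : GL (Fin 2) (w.1.adicCompletion L)) g).1 hu
  refine ⟨u, ?_⟩
  rw [hBg, show UnitaryLatticeTree.latt ((g : GL (Fin 2) (w.1.adicCompletion L)) : Matrix (Fin 2) (Fin 2) (w.1.adicCompletion L)) = UnitaryLatticeTree.mapGL g (stdLattice (w.1.adicCompletion L) 2) from rfl,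
    show g = (u : GL (Fin 2) (w.1.adicCompletion L)) * (((u : GL (Fin 2) (w.1.adicCompletion L)))⁻¹ * g) by rw [mul_inv_cancel_left], UnitaryLatticeTree.mapGL_mul,
    (mapGL_stdLattice_eq_iff_mem_glInt _).2 hk]
end RankTwo

/-! ## §3 The `U₂(L⁺_v) ⧸ K⁰`-coset families of ★ (B-i)∕(B-ii) ARE the W-side lattice families `{B ∣ SD_W, γ₂B = B, Q B}` of the (Cnt2′) axis∕tube census -/

section Conversion
variable (L : Type) [Field L] [NumberField L] [IsCMField L] (v : HeightOneSpectrum (𝓞 ↥(maximalRealSubfield L)))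
  (w : PlacesOver L v) (hw : IsCMField.complexConj L • w.1 = w.1)

set_option maxHeartbeats 1600000 in
include hw in
/-- **COSET FAMILIES OF `U₂(L⁺_v) ⧸ K⁰` = FIXED SELF-DUAL LATTICE FAMILIES OF `W = L_w²`.**  Let `γ₂ ∈ U₂(L⁺_v)` (the `cmDatum` carrier), `Γ := E₂γ₂ ∈ U(σ_w, Φ₂) = U(σ_w, J)`,
`P` a predicate on `2 × 2` matrices which forces integrality and is stable under conjugation by `K_U = U ∩ GL₂(𝒪_w)`, and `Q` a lattice predicate with `P(u⁻¹Γu) ⟺ Q(u·𝒪_w²)`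
whenever `u ∈ U`, `u⁻¹Γu ∈ GL₂(𝒪_w)`.  Then **`#{hK⁰ : P(E₂(h⁻¹γ₂h))} = #{B ⊂ L_w² : B self-dual (rank-N currency, J, any scale |ϖ′| ≤ 1), Γ·B = B, Q B}`** — through
`E₂ : U₂(L⁺_v) ≅ U` (`K⁰ ↦ K_U`), the `∃ h`-form ↦ `fixedBy`-form (§1), and ★ `ncard_fixedBy_quotient_sep_eq_ncard_selfDual_fixed_sep` (root self-dual, `U` transitive: §2).
This is the dictionary by which the (Cnt2′) W-side counts `#{B ∣ SD σ ϖ H₂ B ∧ mapGL γ₂ B = B ∧ P₂ B}` (★ `ncard_selfDual_fixed_axis_eq`) are read off ★ (B-i)∕(B-ii).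
[cite: Kottwitz1986, §3] [cite: Rogawski1990, §4.9 p. 54] [cite: BruhatTits1972, §10] -/
theorem natCard_cosets_eq_ncard_selfDual_fixed (he : v.asIdeal.ramificationIdx' w.1.asIdeal ≠ 1) (h2 : IsUnit (2 : 𝒪[(w.1.adicCompletion L)]))
    {ϖ' : (w.1.adicCompletion L)} (hϖ' : Valued.v ϖ' ≤ 1) (γ₂ : ((cmDatum L 2 (Matrix.of fun i j : Fin 2 => if i.val + j.val + 1 = 2 then (1 : L) else 0)).Local v))
    (P : Matrix (Fin 2) (Fin 2) (w.1.adicCompletion L) → Prop) (hPint : ∀ Y, P Y → ∀ a b, Valued.v (Y a b) ≤ 1)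
    (hPconj : ∀ k : GL (Fin 2) (w.1.adicCompletion L), k ∈ glInt 2 (w.1.adicCompletion L) → k ∈ unitaryGroupOfForm (galAdicCompletionMap (L := L) (IsCMField.complexConj L) hw) (!![(0 : (w.1.adicCompletion L)), 1; 1, 0] : Matrix (Fin 2) (Fin 2) (w.1.adicCompletion L)) →
      ∀ Y : Matrix (Fin 2) (Fin 2) (w.1.adicCompletion L), P Y → P (((k⁻¹ : GL (Fin 2) (w.1.adicCompletion L)) : Matrix (Fin 2) (Fin 2) (w.1.adicCompletion L)) * Y * (k : Matrix (Fin 2) (Fin 2) (w.1.adicCompletion L))))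
    (Q : Submodule (Valued.integer (w.1.adicCompletion L)) (Fin 2 → (w.1.adicCompletion L)) → Prop)
    (hPQ : ∀ u : GL (Fin 2) (w.1.adicCompletion L), u ∈ unitaryGroupOfForm (galAdicCompletionMap (L := L) (IsCMField.complexConj L) hw) (!![(0 : (w.1.adicCompletion L)), 1; 1, 0] : Matrix (Fin 2) (Fin 2) (w.1.adicCompletion L)) →
      u⁻¹ * (((localNonsplitEquiv (IsCMField.complexConj L) (Matrix.of fun i j : Fin 2 => if i.val + j.val + 1 = 2 then (1 : L) else 0) (IsCMField.complexConj_ne_one L) w hw) (γ₂) : ↥(unitaryGroupOfForm (galAdicCompletionMap (L := L) (IsCMField.complexConj L) hw) (placeForm (Matrix.of fun i j : Fin 2 => if i.val + j.val + 1 = 2 then (1 : L) else 0) w.1))) : GL (Fin 2) (w.1.adicCompletion L)) * u ∈ glInt 2 (w.1.adicCompletion L) →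
      (P (((u⁻¹ * (((localNonsplitEquiv (IsCMField.complexConj L) (Matrix.of fun i j : Fin 2 => if i.val + j.val + 1 = 2 then (1 : L) else 0) (IsCMField.complexConj_ne_one L) w hw) (γ₂) : ↥(unitaryGroupOfForm (galAdicCompletionMap (L := L) (IsCMField.complexConj L) hw) (placeForm (Matrix.of fun i j : Fin 2 => if i.val + j.val + 1 = 2 then (1 : L) else 0) w.1))) : GL (Fin 2) (w.1.adicCompletion L)) * u : GL (Fin 2) (w.1.adicCompletion L))) : Matrix (Fin 2) (Fin 2) (w.1.adicCompletion L)) ↔ Q (UnitaryLatticeTree.mapGL u (stdLattice (w.1.adicCompletion L) 2)))) :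
    Nat.card {x : ((cmDatum L 2 (Matrix.of fun i j : Fin 2 => if i.val + j.val + 1 = 2 then (1 : L) else 0)).Local v) ⧸ (cmLocalIntegralLevel L 2 (Matrix.of fun i j : Fin 2 => if i.val + j.val + 1 = 2 then (1 : L) else 0) v) | ∃ h : ((cmDatum L 2 (Matrix.of fun i j : Fin 2 => if i.val + j.val + 1 = 2 then (1 : L) else 0)).Local v), x = (h : ((cmDatum L 2 (Matrix.of fun i j : Fin 2 => if i.val + j.val + 1 = 2 then (1 : L) else 0)).Local v) ⧸ (cmLocalIntegralLevel L 2 (Matrix.of fun i j : Fin 2 => if i.val + j.val + 1 = 2 then (1 : L) else 0) v)) ∧ P (((((localNonsplitEquiv (IsCMField.complexConj L) (Matrix.of fun i j : Fin 2 => if i.val + j.val + 1 = 2 then (1 : L) else 0) (IsCMField.complexConj_ne_one L) w hw) (h⁻¹ * γ₂ * h) : ↥(unitaryGroupOfForm (galAdicCompletionMap (L := L) (IsCMField.complexConj L) hw) (placeForm (Matrix.of fun i j : Fin 2 => if i.val + j.val + 1 = 2 then (1 : L) else 0) w.1))) : GL (Fin 2) (w.1.adicCompletion L)) : Matrix (Fin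 2) (Fin 2) (w.1.adicCompletion L)))} =
      {B : Submodule (Valued.integer (w.1.adicCompletion L)) (Fin 2 → (w.1.adicCompletion L)) | UnitaryLatticeTree.IsSelfDualLattice (galAdicCompletionMap (L := L) (IsCMField.complexConj L) hw) ϖ' (!![(0 : (w.1.adicCompletion L)), 1; 1, 0] : Matrix (Fin 2) (Fin 2) (w.1.adicCompletion L)) B ∧
        UnitaryLatticeTree.mapGL ((((localNonsplitEquiv (IsCMField.complexConj L) (Matrix.of fun i j : Fin 2 => if i.val + j.val + 1 = 2 then (1 : L) else 0) (IsCMField.complexConj_ne_one L) w hw) (γ₂) : ↥(unitaryGroupOfForm (galAdicCompletionMap (L := L) (IsCMField.complexConj L) hw) (placeForm (Matrix.of fun i j : Fin 2 => if i.val + j.val + 1 = 2 then (1 : L) else 0) w.1))) : GL (Fin 2) (w.1.adicCompletion L))) B = B ∧ Q B}.ncard := by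
  -- `U = U(σ_w, J)` and `E₂` landing in it
  have hUeq : unitaryGroupOfForm (galAdicCompletionMap (L := L) (IsCMField.complexConj L) hw) (placeForm (Matrix.of fun i j : Fin 2 => if i.val + j.val + 1 = 2 then (1 : L) else 0) w.1) = unitaryGroupOfForm (galAdicCompletionMap (L := L) (IsCMField.complexConj L) hw) (!![(0 : (w.1.adicCompletion L)), 1; 1, 0] : Matrix (Fin 2) (Fin 2) (w.1.adicCompletion L)) := by
    rw [unitaryGroupOfForm_placeForm_antidiagTwo_eq]
  obtain ⟨Φ, hΦcoe⟩ : ∃ Φ : ((cmDatum L 2 (Matrix.of fun i j : Fin 2 => if i.val + j.val + 1 = 2 then (1 : L) else 0)).Local v) ≃ ↥(unitaryGroupOfForm (galAdicCompletionMap (L := L) (IsCMField.complexConj L) hw) (!![(0 : (w.1.adicCompletion L)), 1; 1, 0] : Matrix (Fin 2) (Fin 2) (w.1.adicCompletion L))),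
      ∀ g : ((cmDatum L 2 (Matrix.of fun i j : Fin 2 => if i.val + j.val + 1 = 2 then (1 : L) else 0)).Local v), ((Φ g : ↥(unitaryGroupOfForm (galAdicCompletionMap (L := L) (IsCMField.complexConj L) hw) (!![(0 : (w.1.adicCompletion L)), 1; 1, 0] : Matrix (Fin 2) (Fin 2) (w.1.adicCompletion L)))) : GL (Fin 2) (w.1.adicCompletion L)) = (((localNonsplitEquiv (IsCMField.complexConj L) (Matrix.of fun i j : Fin 2 => if i.val + j.val + 1 = 2 then (1 : L) else 0) (IsCMField.complexConj_ne_one L) w hw) (g) : ↥(unitaryGroupOfForm (galAdicCompletionMap (L := L) (IsCMField.complexConj L) hw) (placeForm (Matrix.of fun i j : Fin 2 => if i.val + j.val + 1 = 2 then (1 : L) else 0) w.1))) : GL (Fin 2) (w.1.adicCompletion L)) :=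
    ⟨{ toFun := fun g => ⟨(((localNonsplitEquiv (IsCMField.complexConj L) (Matrix.of fun i j : Fin 2 => if i.val + j.val + 1 = 2 then (1 : L) else 0) (IsCMField.complexConj_ne_one L) w hw) (g) : ↥(unitaryGroupOfForm (galAdicCompletionMap (L := L) (IsCMField.complexConj L) hw) (placeForm (Matrix.of fun i j : Fin 2 => if i.val + j.val + 1 = 2 then (1 : L) else 0) w.1))) : GL (Fin 2) (w.1.adicCompletion L)), by rw [← hUeq]; exact ((localNonsplitEquiv (IsCMField.complexConj L) (Matrix.of fun i j : Fin 2 => if i.val + j.val + 1 = 2 then (1 : L) else 0) (IsCMField.complexConj_ne_one L) w hw) g).2⟩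
       invFun := fun x => ((localNonsplitEquiv (IsCMField.complexConj L) (Matrix.of fun i j : Fin 2 => if i.val + j.val + 1 = 2 then (1 : L) else 0) (IsCMField.complexConj_ne_one L) w hw)).symm ⟨(x : GL (Fin 2) (w.1.adicCompletion L)), by rw [hUeq]; exact x.2⟩
       left_inv := fun g => by
         show ((localNonsplitEquiv (IsCMField.complexConj L) (Matrix.of fun i j : Fin 2 => if i.val + j.val + 1 = 2 then (1 : L) else 0) (IsCMField.complexConj_ne_one L) w hw)).symm _ = g
         rw [show (⟨(((localNonsplitEquiv (IsCMField.complexConj L) (Matrix.of fun i j : Fin 2 => if i.val + j.val + 1 = 2 then (1 : L) else 0) (IsCMField.complexConj_ne_one L) w hw) (g) : ↥(unitaryGroupOfForm (galAdicCompletionMap (L := L) (IsCMField.complexConj L) hw) (placeForm (Matrix.of fun i j : Fin 2 => if i.val + j.val + 1 = 2 then (1 : L) else 0) w.1))) : GL (Fin 2) (w.1.adicCompletion L)), ((localNonsplitEquiv (IsCMField.complexConj L) (Matrix.of fun i j : Fin 2 => if i.val + j.val + 1 = 2 then (1 : L) else 0) (IsCMField.complexConj_ne_one L) w hw) g).2⟩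 : ↥(unitaryGroupOfForm (galAdicCompletionMap (L := L) (IsCMField.complexConj L) hw) (placeForm (Matrix.of fun i j : Fin 2 => if i.val + j.val + 1 = 2 then (1 : L) else 0) w.1))) = (localNonsplitEquiv (IsCMField.complexConj L) (Matrix.of fun i j : Fin 2 => if i.val + j.val + 1 = 2 then (1 : L) else 0) (IsCMField.complexConj_ne_one L) w hw) g from Subtype.ext rfl]
         exact ((localNonsplitEquiv (IsCMField.complexConj L) (Matrix.of fun i j : Fin 2 => if i.val + j.val + 1 = 2 then (1 : L) else 0) (IsCMField.complexConj_ne_one L) w hw)).symm_apply_apply g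
       right_inv := fun x => by
         apply Subtype.ext
         show (((localNonsplitEquiv (IsCMField.complexConj L) (Matrix.of fun i j : Fin 2 => if i.val + j.val + 1 = 2 then (1 : L) else 0) (IsCMField.complexConj_ne_one L) w hw) (((localNonsplitEquiv (IsCMField.complexConj L) (Matrix.of fun i j : Fin 2 => if i.val + j.val + 1 = 2 then (1 : L) else 0) (IsCMField.complexConj_ne_one L) w hw)).symm _) : ↥(unitaryGroupOfForm (galAdicCompletionMap (L := L) (IsCMField.complexConj L) hw) (placeForm (Matrix.of fun i j : Fin 2 => if i.val + j.val + 1 = 2 then (1 : L) else 0) w.1))) : GL (Fin 2) (w.1.adicCompletion L)) = (x : GL (Fin 2) (w.1.adicCompletion L))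
         rw [ContinuousMulEquiv.apply_symm_apply] }, fun g => rfl⟩
  -- `E₂` on conjugates, at the `GL₂` level
  have hEconj : ∀ a b : ((cmDatum L 2 (Matrix.of fun i j : Fin 2 => if i.val + j.val + 1 = 2 then (1 : L) else 0)).Local v), (((localNonsplitEquiv (IsCMField.complexConj L) (Matrix.of fun i j : Fin 2 => if i.val + j.val + 1 = 2 then (1 : L) else 0) (IsCMField.complexConj_ne_one L) w hw) (a⁻¹ * b) : ↥(unitaryGroupOfForm (galAdicCompletionMap (L := L) (IsCMField.complexConj L) hw) (placeForm (Matrix.of fun i j : Fin 2 => if i.val + j.val + 1 = 2 then (1 : L) else 0) w.1))) : GL (Fin 2) (w.1.adicCompletion L)) = ((((localNonsplitEquiv (IsCMField.complexConj L) (Matrix.of fun i j : Fin 2 => if i.val + j.val + 1 = 2 then (1 : L) else 0) (IsCMField.complexConj_ne_one L) w hw) (a) : ↥(unitaryGroupOfForm (galAdicCompletionMap (L := L) (IsCMField.complexConj L) hw) (placeForm (Matrix.of fun i j : Fin 2 => if i.val + j.val + 1 = 2 then (1 : L) else 0) w.1))) : GL (Fin 2) (w.1.adicCompletion L)))⁻¹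 * (((localNonsplitEquiv (IsCMField.complexConj L) (Matrix.of fun i j : Fin 2 => if i.val + j.val + 1 = 2 then (1 : L) else 0) (IsCMField.complexConj_ne_one L) w hw) (b) : ↥(unitaryGroupOfForm (galAdicCompletionMap (L := L) (IsCMField.complexConj L) hw) (placeForm (Matrix.of fun i j : Fin 2 => if i.val + j.val + 1 = 2 then (1 : L) else 0) w.1))) : GL (Fin 2) (w.1.adicCompletion L)) := by
    intro a b
    have h1 := map_mul ((localNonsplitEquiv (IsCMField.complexConj L) (Matrix.of fun i j : Fin 2 => if i.val + j.val + 1 = 2 then (1 : L) else 0) (IsCMField.complexConj_ne_one L) w hw)) a⁻¹ b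
    have h3 := map_inv ((localNonsplitEquiv (IsCMField.complexConj L) (Matrix.of fun i j : Fin 2 => if i.val + j.val + 1 = 2 then (1 : L) else 0) (IsCMField.complexConj_ne_one L) w hw)) a
    rw [h3] at h1
    have h4 := congrArg (fun z : ↥(unitaryGroupOfForm (galAdicCompletionMap (L := L) (IsCMField.complexConj L) hw) (placeForm (Matrix.of fun i j : Fin 2 => if i.val + j.val + 1 = 2 then (1 : L) else 0) w.1)) => (z : GL (Fin 2) (w.1.adicCompletion L))) h1
    simp only [Subgroup.coe_mul, Subgroup.coe_inv] at h4
    exact h4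
  have hEconj3 : ∀ x y : ((cmDatum L 2 (Matrix.of fun i j : Fin 2 => if i.val + j.val + 1 = 2 then (1 : L) else 0)).Local v), (((localNonsplitEquiv (IsCMField.complexConj L) (Matrix.of fun i j : Fin 2 => if i.val + j.val + 1 = 2 then (1 : L) else 0) (IsCMField.complexConj_ne_one L) w hw) (y⁻¹ * x * y) : ↥(unitaryGroupOfForm (galAdicCompletionMap (L := L) (IsCMField.complexConj L) hw) (placeForm (Matrix.of fun i j : Fin 2 => if i.val + j.val + 1 = 2 then (1 : L) else 0) w.1))) : GL (Fin 2) (w.1.adicCompletion L)) = ((((localNonsplitEquiv (IsCMField.complexConj L) (Matrix.of fun i j : Fin 2 => if i.val + j.val + 1 = 2 then (1 : L) else 0) (IsCMField.complexConj_ne_one L) w hw) (y) : ↥(unitaryGroupOfForm (galAdicCompletionMap (L := L) (IsCMField.complexConj L) hw) (placeForm (Matrix.of fun i j : Fin 2 => if i.val + j.val + 1 = 2 then (1 : L) else 0) w.1))) : GL (Fin 2) (w.1.adicCompletion L)))⁻¹ * (((localNonsplitEquiv (IsCMField.complexConj L) (Matrix.of fun i j : Fin 2 => if i.val + j.val + 1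 = 2 then (1 : L) else 0) (IsCMField.complexConj_ne_one L) w hw) (x) : ↥(unitaryGroupOfForm (galAdicCompletionMap (L := L) (IsCMField.complexConj L) hw) (placeForm (Matrix.of fun i j : Fin 2 => if i.val + j.val + 1 = 2 then (1 : L) else 0) w.1))) : GL (Fin 2) (w.1.adicCompletion L)) * (((localNonsplitEquiv (IsCMField.complexConj L) (Matrix.of fun i j : Fin 2 => if i.val + j.val + 1 = 2 then (1 : L) else 0) (IsCMField.complexConj_ne_one L) w hw) (y) : ↥(unitaryGroupOfForm (galAdicCompletionMap (L := L) (IsCMField.complexConj L) hw) (placeForm (Matrix.of fun i j : Fin 2 => if i.val + j.val + 1 = 2 then (1 : L) else 0) w.1))) : GL (Fin 2) (w.1.adicCompletion L)) := by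
    intro x y
    have h1 := map_mul ((localNonsplitEquiv (IsCMField.complexConj L) (Matrix.of fun i j : Fin 2 => if i.val + j.val + 1 = 2 then (1 : L) else 0) (IsCMField.complexConj_ne_one L) w hw)) (y⁻¹ * x) y
    have h2 := map_mul ((localNonsplitEquiv (IsCMField.complexConj L) (Matrix.of fun i j : Fin 2 => if i.val + j.val + 1 = 2 then (1 : L) else 0) (IsCMField.complexConj_ne_one L) w hw)) y⁻¹ x
    have h3 := map_inv ((localNonsplitEquiv (IsCMField.complexConj L) (Matrix.of fun i j : Fin 2 => if i.val + j.val + 1 = 2 then (1 : L) else 0) (IsCMField.complexConj_ne_one L) w hw)) y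
    rw [h2, h3] at h1
    have h4 := congrArg (fun z : ↥(unitaryGroupOfForm (galAdicCompletionMap (L := L) (IsCMField.complexConj L) hw) (placeForm (Matrix.of fun i j : Fin 2 => if i.val + j.val + 1 = 2 then (1 : L) else 0) w.1)) => (z : GL (Fin 2) (w.1.adicCompletion L))) h1
    simp only [Subgroup.coe_mul, Subgroup.coe_inv] at h4
    exact h4
  have hK0 : ∀ y : ((cmDatum L 2 (Matrix.of fun i j : Fin 2 => if i.val + j.val + 1 = 2 then (1 : L) else 0)).Local v), y ∈ (cmLocalIntegralLevel L 2 (Matrix.of fun i j : Fin 2 => if i.val + j.val + 1 = 2 then (1 : L) else 0) v) ↔ (((localNonsplitEquiv (IsCMField.complexConj L) (Matrix.of fun i j : Fin 2 => if i.val + j.val + 1 = 2 then (1 : L) else 0) (IsCMField.complexConj_ne_one L) w hw) (y) : ↥(unitaryGroupOfForm (galAdicCompletionMap (L := L) (IsCMField.complexConj L) hw) (placeForm (Matrix.of fun i j : Fin 2 => if i.val + j.val + 1 = 2 then (1 : L) else 0) w.1))) : GL (Fin 2) (w.1.adicCompletion L)) ∈ glInt 2 (w.1.adicCompletion L) :=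
    fun y => mem_localIntegralLevel_iff_of_smul_eq (IsCMField.complexConj L) 2 (Matrix.of fun i j : Fin 2 => if i.val + j.val + 1 = 2 then (1 : L) else 0) (IsCMField.complexConj_ne_one L) w hw y
  -- step 1: through `E₂`, the `U₂(L⁺_v) ⧸ K⁰` family is the `U ⧸ K_U` family
  have hstep1 := natCard_setOf_exists_mk_eq_of_equiv₂ ((cmLocalIntegralLevel L 2 (Matrix.of fun i j : Fin 2 => if i.val + j.val + 1 = 2 then (1 : L) else 0) v)) ((glInt 2 (w.1.adicCompletion L)).subgroupOf (unitaryGroupOfForm (galAdicCompletionMap (L := L) (IsCMField.complexConj L) hw) (!![(0 : (w.1.adicCompletion L)), 1; 1, 0] : Matrix (Fin 2) (Fin 2) (w.1.adicCompletion L)))) Φ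
    (fun g₁ g₂ => by rw [hK0, Subgroup.mem_subgroupOf, Subgroup.coe_mul, Subgroup.coe_inv, hΦcoe, hΦcoe, hEconj])
    (fun g : ((cmDatum L 2 (Matrix.of fun i j : Fin 2 => if i.val + j.val + 1 = 2 then (1 : L) else 0)).Local v) => P (((((localNonsplitEquiv (IsCMField.complexConj L) (Matrix.of fun i j : Fin 2 => if i.val + j.val + 1 = 2 then (1 : L) else 0) (IsCMField.complexConj_ne_one L) w hw) (g⁻¹ * γ₂ * g) : ↥(unitaryGroupOfForm (galAdicCompletionMap (L := L) (IsCMField.complexConj L) hw) (placeForm (Matrix.of fun i j : Fin 2 => if i.val + j.val + 1 = 2 then (1 : L) else 0) w.1))) : GL (Fin 2) (w.1.adicCompletion L)) : Matrix (Fin 2) (Fin 2) (w.1.adicCompletion L))))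
    (fun u : ↥(unitaryGroupOfForm (galAdicCompletionMap (L := L) (IsCMField.complexConj L) hw) (!![(0 : (w.1.adicCompletion L)), 1; 1, 0] : Matrix (Fin 2) (Fin 2) (w.1.adicCompletion L))) =>
      P (((u⁻¹ * Φ γ₂ * u : ↥(unitaryGroupOfForm (galAdicCompletionMap (L := L) (IsCMField.complexConj L) hw) (!![(0 : (w.1.adicCompletion L)), 1; 1, 0] : Matrix (Fin 2) (Fin 2) (w.1.adicCompletion L)))) : GL (Fin 2) (w.1.adicCompletion L)) : Matrix (Fin 2) (Fin 2) (w.1.adicCompletion L)))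
    (fun g => by rw [Subgroup.coe_mul, Subgroup.coe_mul, Subgroup.coe_inv, hΦcoe, hΦcoe, ← hEconj3])
  rw [hstep1]
  -- step 2: the `∃ u`-form is the `fixedBy`-form
  have hdet : Valued.v (((Φ γ₂ : ↥(unitaryGroupOfForm (galAdicCompletionMap (L := L) (IsCMField.complexConj L) hw) (!![(0 : (w.1.adicCompletion L)), 1; 1, 0] : Matrix (Fin 2) (Fin 2) (w.1.adicCompletion L)))) : GL (Fin 2) (w.1.adicCompletion L)) : Matrix (Fin 2) (Fin 2) (w.1.adicCompletion L)).det = 1 := by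
    rw [hΦcoe]; exact v_det_coe_eq_one_of_mem_placeForm L w hw ((localNonsplitEquiv (IsCMField.complexConj L) (Matrix.of fun i j : Fin 2 => if i.val + j.val + 1 = 2 then (1 : L) else 0) (IsCMField.complexConj_ne_one L) w hw) γ₂)
  rw [setOf_exists_mk_eq_setOf_fixedBy (galAdicCompletionMap (L := L) (IsCMField.complexConj L) hw) _ (Φ γ₂) hdet P hPint hPconj, Nat.card_coe_set_eq]
  -- step 3: fixed cosets ↔ fixed self-dual lattices
  have key := ncard_fixedBy_quotient_sep_eq_ncard_selfDual_fixed_sep (galAdicCompletionMap (L := L) (IsCMField.complexConj L) hw) ϖ' (!![(0 : (w.1.adicCompletion L)), 1; 1, 0] : Matrix (Fin 2) (Fin 2) (w.1.adicCompletion L))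
    (isSelfDualLattice_stdLattice_antidiag_two L v w (galAdicCompletionMap (L := L) (IsCMField.complexConj L) hw) hϖ')
    (fun M hM => exists_unitary_mapGL_stdLattice_eq_of_isSelfDualLattice_two L v w hw he h2 M hM) (Φ γ₂)
    (fun g => P (((g : ↥(unitaryGroupOfForm (galAdicCompletionMap (L := L) (IsCMField.complexConj L) hw) (!![(0 : (w.1.adicCompletion L)), 1; 1, 0] : Matrix (Fin 2) (Fin 2) (w.1.adicCompletion L)))) : GL (Fin 2) (w.1.adicCompletion L)) : Matrix (Fin 2) (Fin 2) (w.1.adicCompletion L))) Q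
    (fun g hg => by
      rw [Subgroup.coe_mul, Subgroup.coe_mul, Subgroup.coe_inv, hΦcoe] at hg ⊢
      exact hPQ _ g.2 hg)
  rw [hΦcoe] at key
  exact key
end Conversion

/-! ## §4 The W-side ZERO counts (`LEV(ϖ) ∧ LEV(ϖ²)`) and the W-side CLASS LAW in lattice currency -/

section WSide
variable (L : Type) [Field L] [NumberField L] [IsCMField L] (v : HeightOneSpectrum (𝓞 ↥(maximalRealSubfield L)))
  (w : PlacesOver L v) (hw : IsCMField.complexConj L • w.1 = w.1)

set_option maxHeartbeats 1600000 in
include hw in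
/-- **THE LEVEL TOKEN `LEV(ϖ) ∧ LEV(ϖ²)` READ ON COSETS.**  For `γ₂ ∈ U₂(L⁺_v)` 2-deep at `w` (`|(Γ − 1)_{ij}|_w ≤ |ϖ²|`, `Γ = E₂γ₂`, so `|½tr Γ − 1| ≤ |ϖ²|`): the W-side ZERO family
`{B ∣ SD_W, ΓB = B, (Γ−1)B ⊆ ϖB ∧ (Γ−1)B ⊆ ϖ²B}` has the size of the depth-`2` ball `{hK⁰ : |(E₂(h⁻¹γ₂h) − ½tr Γ·1)_{ab}|_w ≤ |ϖ²|}` of ★ (B-i) (`j = 1`; ★ `map_toLin'_mapGL_stdLattice_le_scaleLattice_iff`,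
`u⁻¹(Γ − 1)u = u⁻¹Γu − 1`). [cite: Kottwitz1986, §3] [cite: Rogawski1990, §4.9 p. 54] [cite: BruhatTits1972, §10] -/
theorem ncard_selfDual_fixed_zero_eq_natCard_depthTwo (he : v.asIdeal.ramificationIdx' w.1.asIdeal ≠ 1) (h2 : IsUnit (2 : 𝒪[(w.1.adicCompletion L)]))
    (ϖ : (w.1.adicCompletion L)ˣ) (hϖ : Valued.v (ϖ : (w.1.adicCompletion L)) = WithZero.exp (-1 : ℤ)) (γ₂ : ((cmDatum L 2 (Matrix.of fun i j : Fin 2 => if i.val + j.val + 1 = 2 then (1 : L) else 0)).Local v))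
    (h2deep : ∀ i j : Fin 2, Valued.v ((((((localNonsplitEquiv (IsCMField.complexConj L) (Matrix.of fun i j : Fin 2 => if i.val + j.val + 1 = 2 then (1 : L) else 0) (IsCMField.complexConj_ne_one L) w hw) (γ₂) : ↥(unitaryGroupOfForm (galAdicCompletionMap (L := L) (IsCMField.complexConj L) hw) (placeForm (Matrix.of fun i j : Fin 2 => if i.val + j.val + 1 = 2 then (1 : L) else 0) w.1))) : GL (Fin 2) (w.1.adicCompletion L)) : Matrix (Fin 2) (Fin 2) (w.1.adicCompletion L)) - 1) i j) ≤ Valued.v ((ϖ : (w.1.adicCompletion L)) ^ 2)) :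
    {B : Submodule (Valued.integer (w.1.adicCompletion L)) (Fin 2 → (w.1.adicCompletion L)) | UnitaryLatticeTree.IsSelfDualLattice (galAdicCompletionMap (L := L) (IsCMField.complexConj L) hw) (ϖ : (w.1.adicCompletion L)) (!![(0 : (w.1.adicCompletion L)), 1; 1, 0] : Matrix (Fin 2) (Fin 2) (w.1.adicCompletion L)) B ∧
        UnitaryLatticeTree.mapGL ((((localNonsplitEquiv (IsCMField.complexConj L) (Matrix.of fun i j : Fin 2 => if i.val + j.val + 1 = 2 then (1 : L) else 0) (IsCMField.complexConj_ne_one L) w hw) (γ₂) : ↥(unitaryGroupOfForm (galAdicCompletionMap (L := L) (IsCMField.complexConj L) hw) (placeForm (Matrix.of fun i j : Fin 2 => if i.val + j.val + 1 = 2 then (1 : L) else 0) w.1))) : GL (Fin 2) (w.1.adicCompletion L))) B = B ∧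
        (B.map ((Matrix.toLin' ((((((localNonsplitEquiv (IsCMField.complexConj L) (Matrix.of fun i j : Fin 2 => if i.val + j.val + 1 = 2 then (1 : L) else 0) (IsCMField.complexConj_ne_one L) w hw) (γ₂) : ↥(unitaryGroupOfForm (galAdicCompletionMap (L := L) (IsCMField.complexConj L) hw) (placeForm (Matrix.of fun i j : Fin 2 => if i.val + j.val + 1 = 2 then (1 : L) else 0) w.1))) : GL (Fin 2) (w.1.adicCompletion L)) : Matrix (Fin 2) (Fin 2) (w.1.adicCompletion L))) - 1)).restrictScalars (Valued.integer (w.1.adicCompletion L))) ≤ UnitaryLatticeTree.scaleLattice (ϖ : (w.1.adicCompletion L)) B ∧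
          B.map ((Matrix.toLin' ((((((localNonsplitEquiv (IsCMField.complexConj L) (Matrix.of fun i j : Fin 2 => if i.val + j.val + 1 = 2 then (1 : L) else 0) (IsCMField.complexConj_ne_one L) w hw) (γ₂) : ↥(unitaryGroupOfForm (galAdicCompletionMap (L := L) (IsCMField.complexConj L) hw) (placeForm (Matrix.of fun i j : Fin 2 => if i.val + j.val + 1 = 2 then (1 : L) else 0) w.1))) : GL (Fin 2) (w.1.adicCompletion L)) : Matrix (Fin 2) (Fin 2) (w.1.adicCompletion L))) - 1)).restrictScalars (Valued.integer (w.1.adicCompletion L))) ≤ UnitaryLatticeTree.scaleLattice ((ϖ : (w.1.adicCompletion L)) ^ 2) B)}.ncard =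
      Nat.card {x : ((cmDatum L 2 (Matrix.of fun i j : Fin 2 => if i.val + j.val + 1 = 2 then (1 : L) else 0)).Local v) ⧸ (cmLocalIntegralLevel L 2 (Matrix.of fun i j : Fin 2 => if i.val + j.val + 1 = 2 then (1 : L) else 0) v) | ∃ h : ((cmDatum L 2 (Matrix.of fun i j : Fin 2 => if i.val + j.val + 1 = 2 then (1 : L) else 0)).Local v), x = (h : ((cmDatum L 2 (Matrix.of fun i j : Fin 2 => if i.val + j.val + 1 = 2 then (1 : L) else 0)).Local v) ⧸ (cmLocalIntegralLevel L 2 (Matrix.of fun i j : Fin 2 => if i.val + j.val + 1 = 2 then (1 : L) else 0) v)) ∧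
        ∀ a b : Fin 2, Valued.v ((((((localNonsplitEquiv (IsCMField.complexConj L) (Matrix.of fun i j : Fin 2 => if i.val + j.val + 1 = 2 then (1 : L) else 0) (IsCMField.complexConj_ne_one L) w hw) (h⁻¹ * γ₂ * h) : ↥(unitaryGroupOfForm (galAdicCompletionMap (L := L) (IsCMField.complexConj L) hw) (placeForm (Matrix.of fun i j : Fin 2 => if i.val + j.val + 1 = 2 then (1 : L) else 0) w.1))) : GL (Fin 2) (w.1.adicCompletion L)) : Matrix (Fin 2) (Fin 2) (w.1.adicCompletion L)) - ((((((localNonsplitEquiv (IsCMField.complexConj L) (Matrix.of fun i j : Fin 2 => if i.val + j.val + 1 = 2 then (1 : L) else 0) (IsCMField.complexConj_ne_one L) w hw) (γ₂) : ↥(unitaryGroupOfForm (galAdicCompletionMap (L := L) (IsCMField.complexConj L) hw) (placeForm (Matrix.of fun i j : Fin 2 => if i.val + j.val + 1 = 2 then (1 : L) else 0) w.1))) : GL (Fin 2) (w.1.adicCompletion L)) : Matrix (Fin 2) (Fin 2) (w.1.adicCompletion L))).trace / 2) • (1 : Matrix (Fin 2) (Fin 2) (w.1.adicCompletion L))) a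 b) ≤ Valued.v ((ϖ : (w.1.adicCompletion L)) ^ (2 * 1))} := by
  have hϖ0 : (ϖ : (w.1.adicCompletion L)) ≠ 0 := ϖ.ne_zero
  have hϖ1 : Valued.v (ϖ : (w.1.adicCompletion L)) ≤ 1 := by rw [hϖ, ← WithZero.exp_zero]; exact WithZero.exp_le_exp.2 (by norm_num)
  obtain ⟨h2v, h2v0⟩ := valued_two_eq_one_of_isUnit_two_of_ramified L v w hw he h2
  have h2w : Valued.v (2 : (w.1.adicCompletion L)) = 1 := (isUnit_two_integer_iff_valued_eq_one L w.1).1 h2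
  -- `|½ tr Γ − 1| ≤ |ϖ²|`
  have hc : Valued.v ((((((localNonsplitEquiv (IsCMField.complexConj L) (Matrix.of fun i j : Fin 2 => if i.val + j.val + 1 = 2 then (1 : L) else 0) (IsCMField.complexConj_ne_one L) w hw) (γ₂) : ↥(unitaryGroupOfForm (galAdicCompletionMap (L := L) (IsCMField.complexConj L) hw) (placeForm (Matrix.of fun i j : Fin 2 => if i.val + j.val + 1 = 2 then (1 : L) else 0) w.1))) : GL (Fin 2) (w.1.adicCompletion L)) : Matrix (Fin 2) (Fin 2) (w.1.adicCompletion L))).trace / 2 - 1) ≤ Valued.v ((ϖ : (w.1.adicCompletion L)) ^ 2) := by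
    have e : (((((localNonsplitEquiv (IsCMField.complexConj L) (Matrix.of fun i j : Fin 2 => if i.val + j.val + 1 = 2 then (1 : L) else 0) (IsCMField.complexConj_ne_one L) w hw) (γ₂) : ↥(unitaryGroupOfForm (galAdicCompletionMap (L := L) (IsCMField.complexConj L) hw) (placeForm (Matrix.of fun i j : Fin 2 => if i.val + j.val + 1 = 2 then (1 : L) else 0) w.1))) : GL (Fin 2) (w.1.adicCompletion L)) : Matrix (Fin 2) (Fin 2) (w.1.adicCompletion L))).trace / 2 - 1 = ((((((localNonsplitEquiv (IsCMField.complexConj L) (Matrix.of fun i j : Fin 2 => if i.val + j.val + 1 = 2 then (1 : L) else 0) (IsCMField.complexConj_ne_one L) w hw) (γ₂) : ↥(unitaryGroupOfForm (galAdicCompletionMap (L := L) (IsCMField.complexConj L) hw) (placeForm (Matrix.of fun i j : Fin 2 => if i.val + j.val + 1 = 2 then (1 : L) else 0) w.1))) : GL (Fin 2) (w.1.adicCompletion L)) : Matrix (Fin 2) (Fin 2) (w.1.adicCompletion L)) - 1) 0 0 + (((((localNonsplitEquiv (IsCMField.complexConj L) (Matrix.of fun i j : Fin 2 => if i.val + j.val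 + 1 = 2 then (1 : L) else 0) (IsCMField.complexConj_ne_one L) w hw) (γ₂) : ↥(unitaryGroupOfForm (galAdicCompletionMap (L := L) (IsCMField.complexConj L) hw) (placeForm (Matrix.of fun i j : Fin 2 => if i.val + j.val + 1 = 2 then (1 : L) else 0) w.1))) : GL (Fin 2) (w.1.adicCompletion L)) : Matrix (Fin 2) (Fin 2) (w.1.adicCompletion L)) - 1) 1 1) / 2 := by
      rw [Matrix.trace_fin_two]; simp only [Matrix.sub_apply, Matrix.one_apply_eq]; ring
    rw [e, map_div₀, h2w, div_one]
    exact le_trans (Valuation.map_add _ _ _) (max_le (h2deep 0 0) (h2deep 1 1))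
  -- the two entrywise predicates `|(Y − 1)_{ab}| ≤ |ϖ²|` and `|(Y − c·1)_{ab}| ≤ |ϖ²|` agree
  have hPiff : ∀ Y : Matrix (Fin 2) (Fin 2) (w.1.adicCompletion L), (∀ a b : Fin 2, Valued.v ((Y - 1) a b) ≤ Valued.v ((ϖ : (w.1.adicCompletion L)) ^ 2)) ↔
      (∀ a b : Fin 2, Valued.v ((Y - ((((((localNonsplitEquiv (IsCMField.complexConj L) (Matrix.of fun i j : Fin 2 => if i.val + j.val + 1 = 2 then (1 : L) else 0) (IsCMField.complexConj_ne_one L) w hw) (γ₂) : ↥(unitaryGroupOfForm (galAdicCompletionMap (L := L) (IsCMField.complexConj L) hw) (placeForm (Matrix.of fun i j : Fin 2 => if i.val + j.val + 1 = 2 then (1 : L) else 0) w.1))) : GL (Fin 2) (w.1.adicCompletion L)) : Matrix (Fin 2) (Fin 2) (w.1.adicCompletion L))).trace / 2) • (1 : Matrix (Fin 2) (Fin 2) (w.1.adicCompletion L))) a b) ≤ Valued.v ((ϖ : (w.1.adicCompletion L)) ^ (2 * 1))) := by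
    intro Y
    have e : ∀ a b : Fin 2, (Y - ((((((localNonsplitEquiv (IsCMField.complexConj L) (Matrix.of fun i j : Fin 2 => if i.val + j.val + 1 = 2 then (1 : L) else 0) (IsCMField.complexConj_ne_one L) w hw) (γ₂) : ↥(unitaryGroupOfForm (galAdicCompletionMap (L := L) (IsCMField.complexConj L) hw) (placeForm (Matrix.of fun i j : Fin 2 => if i.val + j.val + 1 = 2 then (1 : L) else 0) w.1))) : GL (Fin 2) (w.1.adicCompletion L)) : Matrix (Fin 2) (Fin 2) (w.1.adicCompletion L))).trace / 2) • (1 : Matrix (Fin 2) (Fin 2) (w.1.adicCompletion L))) a b = (Y - 1) a b - ((((((localNonsplitEquiv (IsCMField.complexConj L) (Matrix.of fun i j : Fin 2 => if i.val + j.val + 1 = 2 then (1 : L) else 0) (IsCMField.complexConj_ne_one L) w hw) (γ₂) : ↥(unitaryGroupOfForm (galAdicCompletionMap (L := L) (IsCMField.complexConj L) hw) (placeForm (Matrix.of fun i j : Fin 2 => if i.val + j.val + 1 = 2 then (1 : L) else 0) w.1))) : GL (Fin 2) (w.1.adicCompletion L)) : Matrix (Fin 2) (Fin 2) (w.1.adicCompletion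 L))).trace / 2 - 1) * (1 : Matrix (Fin 2) (Fin 2) (w.1.adicCompletion L)) a b := by
      intro a b; simp only [Matrix.sub_apply, Matrix.smul_apply, smul_eq_mul]; ring
    have e' : ∀ a b : Fin 2, (Y - 1) a b = (Y - ((((((localNonsplitEquiv (IsCMField.complexConj L) (Matrix.of fun i j : Fin 2 => if i.val + j.val + 1 = 2 then (1 : L) else 0) (IsCMField.complexConj_ne_one L) w hw) (γ₂) : ↥(unitaryGroupOfForm (galAdicCompletionMap (L := L) (IsCMField.complexConj L) hw) (placeForm (Matrix.of fun i j : Fin 2 => if i.val + j.val + 1 = 2 then (1 : L) else 0) w.1))) : GL (Fin 2) (w.1.adicCompletion L)) : Matrix (Fin 2) (Fin 2) (w.1.adicCompletion L))).trace / 2) • (1 : Matrix (Fin 2) (Fin 2) (w.1.adicCompletion L))) a b + ((((((localNonsplitEquiv (IsCMField.complexConj L) (Matrix.of fun i j : Fin 2 => if i.val + j.val + 1 = 2 then (1 : L) else 0) (IsCMField.complexConj_ne_one L) w hw) (γ₂) : ↥(unitaryGroupOfForm (galAdicCompletionMap (L := L) (IsCMField.complexConj L) hw) (placeForm (Matrix.of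 fun i j : Fin 2 => if i.val + j.val + 1 = 2 then (1 : L) else 0) w.1))) : GL (Fin 2) (w.1.adicCompletion L)) : Matrix (Fin 2) (Fin 2) (w.1.adicCompletion L))).trace / 2 - 1) * (1 : Matrix (Fin 2) (Fin 2) (w.1.adicCompletion L)) a b := by
      intro a b; rw [e]; ring
    have hcab : ∀ a b : Fin 2, Valued.v (((((((localNonsplitEquiv (IsCMField.complexConj L) (Matrix.of fun i j : Fin 2 => if i.val + j.val + 1 = 2 then (1 : L) else 0) (IsCMField.complexConj_ne_one L) w hw) (γ₂) : ↥(unitaryGroupOfForm (galAdicCompletionMap (L := L) (IsCMField.complexConj L) hw) (placeForm (Matrix.of fun i j : Fin 2 => if i.val + j.val + 1 = 2 then (1 : L) else 0) w.1))) : GL (Fin 2) (w.1.adicCompletion L)) : Matrix (Fin 2) (Fin 2) (w.1.adicCompletion L))).trace / 2 - 1) * (1 : Matrix (Fin 2) (Fin 2) (w.1.adicCompletion L)) a b) ≤ Valued.v ((ϖ : (w.1.adicCompletion L)) ^ 2) := by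
      intro a b
      rw [map_mul]
      by_cases hab : a = b
      · rw [hab, Matrix.one_apply_eq, map_one, mul_one]; exact hc
      · rw [Matrix.one_apply_ne hab, map_zero, mul_zero]; exact zero_le
    rw [show 2 * 1 = 2 from rfl]
    constructor
    · intro h a b
      rw [e]
      exact le_trans (Valuation.map_sub _ _ _) (max_le (h a b) (hcab a b))
    · intro h a b
      rw [e']
      exact le_trans (Valuation.map_add _ _ _) (max_le (h a b) (hcab a b))
  symm
  refine natCard_cosets_eq_ncard_selfDual_fixed L v w hw he h2 hϖ1 γ₂
    (fun Y : Matrix (Fin 2) (Fin 2) (w.1.adicCompletion L) => ∀ a b : Fin 2, Valued.v ((Y - ((((((localNonsplitEquiv (IsCMField.complexConj L) (Matrix.of fun i j : Fin 2 => if i.val + j.val + 1 = 2 then (1 : L) else 0) (IsCMField.complexConj_ne_one L) w hw) (γ₂) : ↥(unitaryGroupOfForm (galAdicCompletionMap (L := L) (IsCMField.complexConj L) hw) (placeForm (Matrix.of fun i j : Fin 2 => if i.val + j.val + 1 = 2 then (1 : L) else 0) w.1))) : GL (Fin 2) (w.1.adicCompletion L)) : Matrix (Fin 2) (Fin 2)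 (w.1.adicCompletion L))).trace / 2) • (1 : Matrix (Fin 2) (Fin 2) (w.1.adicCompletion L))) a b) ≤ Valued.v ((ϖ : (w.1.adicCompletion L)) ^ (2 * 1)))
    (fun Y hY a b => ?_) (fun k hk hkU Y hY => ?_)
    (fun B : Submodule (Valued.integer (w.1.adicCompletion L)) (Fin 2 → (w.1.adicCompletion L)) =>
      B.map ((Matrix.toLin' ((((((localNonsplitEquiv (IsCMField.complexConj L) (Matrix.of fun i j : Fin 2 => if i.val + j.val + 1 = 2 then (1 : L) else 0) (IsCMField.complexConj_ne_one L) w hw) (γ₂) : ↥(unitaryGroupOfForm (galAdicCompletionMap (L := L) (IsCMField.complexConj L) hw) (placeForm (Matrix.of fun i j : Fin 2 => if i.val + j.val + 1 = 2 then (1 : L) else 0) w.1))) : GL (Fin 2) (w.1.adicCompletion L)) : Matrix (Fin 2) (Fin 2) (w.1.adicCompletion L))) - 1)).restrictScalars (Valued.integer (w.1.adicCompletion L))) ≤ UnitaryLatticeTree.scaleLattice (ϖ : (w.1.adicCompletion L)) B ∧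
        B.map ((Matrix.toLin' ((((((localNonsplitEquiv (IsCMField.complexConj L) (Matrix.of fun i j : Fin 2 => if i.val + j.val + 1 = 2 then (1 : L) else 0) (IsCMField.complexConj_ne_one L) w hw) (γ₂) : ↥(unitaryGroupOfForm (galAdicCompletionMap (L := L) (IsCMField.complexConj L) hw) (placeForm (Matrix.of fun i j : Fin 2 => if i.val + j.val + 1 = 2 then (1 : L) else 0) w.1))) : GL (Fin 2) (w.1.adicCompletion L)) : Matrix (Fin 2) (Fin 2) (w.1.adicCompletion L))) - 1)).restrictScalars (Valued.integer (w.1.adicCompletion L))) ≤ UnitaryLatticeTree.scaleLattice ((ϖ : (w.1.adicCompletion L)) ^ 2) B)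
    (fun u hu hug => ?_)
  · -- integrality: `|Y_{ab}| ≤ max(|(Y − c1)_{ab}|, |c·1_{ab}|) ≤ 1`
    have hY' := ((hPiff Y).2 hY) a b
    have hc1 : Valued.v (((((((localNonsplitEquiv (IsCMField.complexConj L) (Matrix.of fun i j : Fin 2 => if i.val + j.val + 1 = 2 then (1 : L) else 0) (IsCMField.complexConj_ne_one L) w hw) (γ₂) : ↥(unitaryGroupOfForm (galAdicCompletionMap (L := L) (IsCMField.complexConj L) hw) (placeForm (Matrix.of fun i j : Fin 2 => if i.val + j.val + 1 = 2 then (1 : L) else 0) w.1))) : GL (Fin 2) (w.1.adicCompletion L)) : Matrix (Fin 2) (Fin 2) (w.1.adicCompletion L))).trace / 2 - 1) + 1) ≤ 1 := by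
      refine le_trans (Valuation.map_add _ _ _) (max_le (le_trans hc ?_) (by rw [map_one]))
      rw [map_pow]; exact pow_le_one₀ zero_le hϖ1
    have e : Y a b = (Y - 1) a b + (1 : Matrix (Fin 2) (Fin 2) (w.1.adicCompletion L)) a b := by simp only [Matrix.sub_apply]; ring
    rw [e]
    refine le_trans (Valuation.map_add _ _ _) (max_le (le_trans hY' ?_) ?_)
    · rw [map_pow]; exact pow_le_one₀ zero_le hϖ1
    · by_cases hab : a = b
      · rw [hab, Matrix.one_apply_eq, map_one]
      · rw [Matrix.one_apply_ne hab, map_zero]; exact zero_le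
  · -- conjugation invariance under `K_U ⊆ GL₂(𝒪_w)`
    rw [← hPiff] at hY ⊢
    have hkk' : ((k⁻¹ : GL (Fin 2) (w.1.adicCompletion L)) : Matrix (Fin 2) (Fin 2) (w.1.adicCompletion L)) * ((k⁻¹⁻¹ : GL (Fin 2) (w.1.adicCompletion L)) : Matrix (Fin 2) (Fin 2) (w.1.adicCompletion L)) = 1 := by
      rw [← Units.val_mul, mul_inv_cancel, Units.val_one]
    have hk'k : ((k⁻¹⁻¹ : GL (Fin 2) (w.1.adicCompletion L)) : Matrix (Fin 2) (Fin 2) (w.1.adicCompletion L)) * ((k⁻¹ : GL (Fin 2) (w.1.adicCompletion L)) : Matrix (Fin 2) (Fin 2) (w.1.adicCompletion L)) = 1 := by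
      rw [← Units.val_mul, inv_mul_cancel, Units.val_one]
    have hki := ((HermitianLatticeTree.mem_glInt_iff_forall_v_le_one_and_v_det_eq_one k⁻¹).1 (inv_mem hk)).1
    have hk'i := ((HermitianLatticeTree.mem_glInt_iff_forall_v_le_one_and_v_det_eq_one k⁻¹⁻¹).1 (inv_mem (inv_mem hk))).1
    have h := (forall_v_conj_sub_smul_one_le_iff w.1 hkk' hk'k hki hk'i (1 : (w.1.adicCompletion L)) Y (Valued.v ((ϖ : (w.1.adicCompletion L)) ^ 2))).2 (by simpa only [one_smul] using hY)
    rw [inv_inv] at h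
    simpa only [one_smul] using h
  · -- the lattice token ↔ the coset token
    rw [map_toLin'_mapGL_stdLattice_le_scaleLattice_iff hϖ0, map_toLin'_mapGL_stdLattice_le_scaleLattice_iff (pow_ne_zero 2 hϖ0), ← hPiff,
      ← units_coe_inv_mul_mul_sub_one_eq_conj]
    constructor
    · intro h
      refine ⟨fun a b => le_trans (h a b) ?_, h⟩
      rw [map_pow, sq]; exact mul_le_of_le_one_left zero_le hϖ1
    · intro h; exact h.2

include hw in
/-- **W-SIDE ZERO COUNT, EVEN DEPTH `2n`, `n ≥ 2`**: for a type-(2) `γ₂` (2-deep at `w`) the W-side ZERO family `{B ∣ SD_W, ΓB = B, LEV(ϖ) ∧ LEV(ϖ²)}` has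
**`(q+1)·Σ_(k<n−1) q^k`** elements (★ II `natCard_depthFixed_selfDual_and_modular_of_even_depth_ramified` at `j = 1`; `C′` = the canonical `K♯` of ★ `exists_subgroup_forall_mem_iff_sharp`).
The axis summand of row `0` (★ `ncard_selfDual_fixed_axis_zero_eq`). [cite: LabesseLanglands1979, §2 Lemma 2.1 p. 8] [cite: Rogawski1990, §4.9 p. 56] [cite: BruhatTits1972, §10] -/
theorem ncard_selfDual_fixed_zero_of_even_depth_ramified (he : v.asIdeal.ramificationIdx' w.1.asIdeal ≠ 1) (h2 : IsUnit (2 : 𝒪[(w.1.adicCompletion L)]))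
    (ϖ : (w.1.adicCompletion L)ˣ) (hϖ : Valued.v (ϖ : (w.1.adicCompletion L)) = WithZero.exp (-1 : ℤ))
    (hσϖ : (galAdicCompletionMap (L := L) (IsCMField.complexConj L) hw) (ϖ : (w.1.adicCompletion L)) = -(ϖ : (w.1.adicCompletion L))) (γ₂ : ((cmDatum L 2 (Matrix.of fun i j : Fin 2 => if i.val + j.val + 1 = 2 then (1 : L) else 0)).Local v))
    (hirr : ¬ ∃ x : (w.1.adicCompletion L), ((((((localNonsplitEquiv (IsCMField.complexConj L) (Matrix.of fun i j : Fin 2 => if i.val + j.val + 1 = 2 then (1 : L) else 0) (IsCMField.complexConj_ne_one L) w hw) (γ₂) : ↥(unitaryGroupOfForm (galAdicCompletionMap (L := L) (IsCMField.complexConj L) hw) (placeForm (Matrix.of fun i j : Fin 2 => if i.val + j.val + 1 = 2 then (1 : L) else 0) w.1))) : GL (Fin 2) (w.1.adicCompletion L)) : Matrix (Fin 2) (Fin 2) (w.1.adicCompletion L))).charpoly).IsRoot x)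
    (h2deep : ∀ i j : Fin 2, Valued.v ((((((localNonsplitEquiv (IsCMField.complexConj L) (Matrix.of fun i j : Fin 2 => if i.val + j.val + 1 = 2 then (1 : L) else 0) (IsCMField.complexConj_ne_one L) w hw) (γ₂) : ↥(unitaryGroupOfForm (galAdicCompletionMap (L := L) (IsCMField.complexConj L) hw) (placeForm (Matrix.of fun i j : Fin 2 => if i.val + j.val + 1 = 2 then (1 : L) else 0) w.1))) : GL (Fin 2) (w.1.adicCompletion L)) : Matrix (Fin 2) (Fin 2) (w.1.adicCompletion L)) - 1) i j) ≤ Valued.v ((ϖ : (w.1.adicCompletion L)) ^ 2))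
    {n : ℕ} (hn2 : 2 ≤ n) (hN : Valued.v ((((((localNonsplitEquiv (IsCMField.complexConj L) (Matrix.of fun i j : Fin 2 => if i.val + j.val + 1 = 2 then (1 : L) else 0) (IsCMField.complexConj_ne_one L) w hw) (γ₂) : ↥(unitaryGroupOfForm (galAdicCompletionMap (L := L) (IsCMField.complexConj L) hw) (placeForm (Matrix.of fun i j : Fin 2 => if i.val + j.val + 1 = 2 then (1 : L) else 0) w.1))) : GL (Fin 2) (w.1.adicCompletion L)) : Matrix (Fin 2) (Fin 2) (w.1.adicCompletion L))).trace ^ 2 - 4 * (((((localNonsplitEquiv (IsCMField.complexConj L) (Matrix.of fun i j : Fin 2 => if i.val + j.val + 1 = 2 then (1 : L) else 0) (IsCMField.complexConj_ne_one L) w hw) (γ₂) : ↥(unitaryGroupOfForm (galAdicCompletionMap (L := L) (IsCMField.complexConj L) hw) (placeForm (Matrix.of fun i j : Fin 2 => if i.val + j.val + 1 = 2 then (1 : L) else 0) w.1))) : GL (Fin 2) (w.1.adicCompletion L)) : Matrix (Fin 2) (Fin 2) (w.1.adicCompletion L))).det) = WithZero.exp (-((2 * (2 * n) : ℕ) : ℤ)))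 :
    {B : Submodule (Valued.integer (w.1.adicCompletion L)) (Fin 2 → (w.1.adicCompletion L)) | UnitaryLatticeTree.IsSelfDualLattice (galAdicCompletionMap (L := L) (IsCMField.complexConj L) hw) (ϖ : (w.1.adicCompletion L)) (!![(0 : (w.1.adicCompletion L)), 1; 1, 0] : Matrix (Fin 2) (Fin 2) (w.1.adicCompletion L)) B ∧
        UnitaryLatticeTree.mapGL ((((localNonsplitEquiv (IsCMField.complexConj L) (Matrix.of fun i j : Fin 2 => if i.val + j.val + 1 = 2 then (1 : L) else 0) (IsCMField.complexConj_ne_one L) w hw) (γ₂) : ↥(unitaryGroupOfForm (galAdicCompletionMap (L := L) (IsCMField.complexConj L) hw) (placeForm (Matrix.of fun i j : Fin 2 => if i.val + j.val + 1 = 2 then (1 : L) else 0) w.1))) : GL (Fin 2) (w.1.adicCompletion L))) B = B ∧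
        (B.map ((Matrix.toLin' ((((((localNonsplitEquiv (IsCMField.complexConj L) (Matrix.of fun i j : Fin 2 => if i.val + j.val + 1 = 2 then (1 : L) else 0) (IsCMField.complexConj_ne_one L) w hw) (γ₂) : ↥(unitaryGroupOfForm (galAdicCompletionMap (L := L) (IsCMField.complexConj L) hw) (placeForm (Matrix.of fun i j : Fin 2 => if i.val + j.val + 1 = 2 then (1 : L) else 0) w.1))) : GL (Fin 2) (w.1.adicCompletion L)) : Matrix (Fin 2) (Fin 2) (w.1.adicCompletion L))) - 1)).restrictScalars (Valued.integer (w.1.adicCompletion L))) ≤ UnitaryLatticeTree.scaleLattice (ϖ : (w.1.adicCompletion L)) B ∧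
          B.map ((Matrix.toLin' ((((((localNonsplitEquiv (IsCMField.complexConj L) (Matrix.of fun i j : Fin 2 => if i.val + j.val + 1 = 2 then (1 : L) else 0) (IsCMField.complexConj_ne_one L) w hw) (γ₂) : ↥(unitaryGroupOfForm (galAdicCompletionMap (L := L) (IsCMField.complexConj L) hw) (placeForm (Matrix.of fun i j : Fin 2 => if i.val + j.val + 1 = 2 then (1 : L) else 0) w.1))) : GL (Fin 2) (w.1.adicCompletion L)) : Matrix (Fin 2) (Fin 2) (w.1.adicCompletion L))) - 1)).restrictScalars (Valued.integer (w.1.adicCompletion L))) ≤ UnitaryLatticeTree.scaleLattice ((ϖ : (w.1.adicCompletion L)) ^ 2) B)}.ncard =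
      (Nat.card (𝓞 ↥(maximalRealSubfield L) ⧸ v.asIdeal) + 1) * ∑ k ∈ Finset.range (n - 1), Nat.card (𝓞 ↥(maximalRealSubfield L) ⧸ v.asIdeal) ^ k := by
  obtain ⟨C', hC's⟩ := exists_subgroup_forall_mem_iff_sharp L v w hw (ϖ : (w.1.adicCompletion L)) hϖ
  obtain ⟨hC'c, hC'o⟩ := isCompact_and_isOpen_of_forall_mem_iff_sharp L v w hw (ϖ : (w.1.adicCompletion L)) hϖ C' hC's
  have hC' : ∀ g : ((cmDatum L 2 (Matrix.of fun i j : Fin 2 => if i.val + j.val + 1 = 2 then (1 : L) else 0)).Local v), g ∈ C' ↔ (((localNonsplitEquiv (IsCMField.complexConj L) (Matrix.of fun i j : Fin 2 => if i.val + j.val + 1 = 2 then (1 : L) else 0) (IsCMField.complexConj_ne_one L) w hw) (g) : ↥(unitaryGroupOfForm (galAdicCompletionMap (L := L) (IsCMField.complexConj L) hw) (placeForm (Matrix.of fun i j : Fin 2 => if i.val + j.val + 1 = 2 then (1 : L) else 0) w.1))) : GL (Fin 2) (w.1.adicCompletion L)) ∈ (glInt 2 (w.1.adicCompletion L)).map (MulAut.conj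 (glDiagonal 2 (w.1.adicCompletion L) ![1, ϖ])).toMonoidHom :=
    fun g => (hC's g).trans (forall_v_sharp_iff_coe_mem_map_conj L w hw ϖ ((localNonsplitEquiv (IsCMField.complexConj L) (Matrix.of fun i j : Fin 2 => if i.val + j.val + 1 = 2 then (1 : L) else 0) (IsCMField.complexConj_ne_one L) w hw) g))
  rw [ncard_selfDual_fixed_zero_eq_natCard_depthTwo L v w hw he h2 ϖ hϖ γ₂ h2deep]
  exact (natCard_depthFixed_selfDual_and_modular_of_even_depth_ramified L v w hw he h2 ϖ hϖ hσϖ C' hC' hC'o hC'c γ₂ hirr hN (j := 1) (by omega)).1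

include hw in
/-- **W-SIDE ZERO COUNT, EVEN DEPTH `2` (`n = 1`)**: the W-side ZERO family is EMPTY (★ IV `depthFixed_selfDual_top_eq_empty_of_even_depth_ramified`: no self-dual lattice of `W`
is fixed to depth `2n` by a type-(2) element of depth `2n`). [cite: LabesseLanglands1979, §2 Lemma 2.1 p. 8] [cite: Rogawski1990, §4.9 p. 56] -/
theorem ncard_selfDual_fixed_zero_of_even_depth_two_ramified (he : v.asIdeal.ramificationIdx' w.1.asIdeal ≠ 1) (h2 : IsUnit (2 : 𝒪[(w.1.adicCompletion L)]))
    (ϖ : (w.1.adicCompletion L)ˣ) (hϖ : Valued.v (ϖ : (w.1.adicCompletion L)) = WithZero.exp (-1 : ℤ))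
    (hσϖ : (galAdicCompletionMap (L := L) (IsCMField.complexConj L) hw) (ϖ : (w.1.adicCompletion L)) = -(ϖ : (w.1.adicCompletion L))) (γ₂ : ((cmDatum L 2 (Matrix.of fun i j : Fin 2 => if i.val + j.val + 1 = 2 then (1 : L) else 0)).Local v))
    (hirr : ¬ ∃ x : (w.1.adicCompletion L), ((((((localNonsplitEquiv (IsCMField.complexConj L) (Matrix.of fun i j : Fin 2 => if i.val + j.val + 1 = 2 then (1 : L) else 0) (IsCMField.complexConj_ne_one L) w hw) (γ₂) : ↥(unitaryGroupOfForm (galAdicCompletionMap (L := L) (IsCMField.complexConj L) hw) (placeForm (Matrix.of fun i j : Fin 2 => if i.val + j.val + 1 = 2 then (1 : L) else 0) w.1))) : GL (Fin 2) (w.1.adicCompletion L)) : Matrix (Fin 2) (Fin 2) (w.1.adicCompletion L))).charpoly).IsRoot x)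
    (h2deep : ∀ i j : Fin 2, Valued.v ((((((localNonsplitEquiv (IsCMField.complexConj L) (Matrix.of fun i j : Fin 2 => if i.val + j.val + 1 = 2 then (1 : L) else 0) (IsCMField.complexConj_ne_one L) w hw) (γ₂) : ↥(unitaryGroupOfForm (galAdicCompletionMap (L := L) (IsCMField.complexConj L) hw) (placeForm (Matrix.of fun i j : Fin 2 => if i.val + j.val + 1 = 2 then (1 : L) else 0) w.1))) : GL (Fin 2) (w.1.adicCompletion L)) : Matrix (Fin 2) (Fin 2) (w.1.adicCompletion L)) - 1) i j) ≤ Valued.v ((ϖ : (w.1.adicCompletion L)) ^ 2))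
    (hN : Valued.v ((((((localNonsplitEquiv (IsCMField.complexConj L) (Matrix.of fun i j : Fin 2 => if i.val + j.val + 1 = 2 then (1 : L) else 0) (IsCMField.complexConj_ne_one L) w hw) (γ₂) : ↥(unitaryGroupOfForm (galAdicCompletionMap (L := L) (IsCMField.complexConj L) hw) (placeForm (Matrix.of fun i j : Fin 2 => if i.val + j.val + 1 = 2 then (1 : L) else 0) w.1))) : GL (Fin 2) (w.1.adicCompletion L)) : Matrix (Fin 2) (Fin 2) (w.1.adicCompletion L))).trace ^ 2 - 4 * (((((localNonsplitEquiv (IsCMField.complexConj L) (Matrix.of fun i j : Fin 2 => if i.val + j.val + 1 = 2 then (1 : L) else 0) (IsCMField.complexConj_ne_one L) w hw) (γ₂) : ↥(unitaryGroupOfForm (galAdicCompletionMap (L := L) (IsCMField.complexConj L) hw) (placeForm (Matrix.of fun i j : Fin 2 => if i.val + j.val + 1 = 2 then (1 : L) else 0) w.1))) : GL (Fin 2) (w.1.adicCompletion L)) : Matrix (Fin 2) (Fin 2) (w.1.adicCompletion L))).det) = WithZero.exp (-((2 * (2 * 1) : ℕ) : ℤ))) :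
    {B : Submodule (Valued.integer (w.1.adicCompletion L)) (Fin 2 → (w.1.adicCompletion L)) | UnitaryLatticeTree.IsSelfDualLattice (galAdicCompletionMap (L := L) (IsCMField.complexConj L) hw) (ϖ : (w.1.adicCompletion L)) (!![(0 : (w.1.adicCompletion L)), 1; 1, 0] : Matrix (Fin 2) (Fin 2) (w.1.adicCompletion L)) B ∧
        UnitaryLatticeTree.mapGL ((((localNonsplitEquiv (IsCMField.complexConj L) (Matrix.of fun i j : Fin 2 => if i.val + j.val + 1 = 2 then (1 : L) else 0) (IsCMField.complexConj_ne_one L) w hw) (γ₂) : ↥(unitaryGroupOfForm (galAdicCompletionMap (L := L) (IsCMField.complexConj L) hw) (placeForm (Matrix.of fun i j : Fin 2 => if i.val + j.val + 1 = 2 then (1 : L) else 0) w.1))) : GL (Fin 2) (w.1.adicCompletion L))) B = B ∧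
        (B.map ((Matrix.toLin' ((((((localNonsplitEquiv (IsCMField.complexConj L) (Matrix.of fun i j : Fin 2 => if i.val + j.val + 1 = 2 then (1 : L) else 0) (IsCMField.complexConj_ne_one L) w hw) (γ₂) : ↥(unitaryGroupOfForm (galAdicCompletionMap (L := L) (IsCMField.complexConj L) hw) (placeForm (Matrix.of fun i j : Fin 2 => if i.val + j.val + 1 = 2 then (1 : L) else 0) w.1))) : GL (Fin 2) (w.1.adicCompletion L)) : Matrix (Fin 2) (Fin 2) (w.1.adicCompletion L))) - 1)).restrictScalars (Valued.integer (w.1.adicCompletion L))) ≤ UnitaryLatticeTree.scaleLattice (ϖ : (w.1.adicCompletion L)) B ∧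
          B.map ((Matrix.toLin' ((((((localNonsplitEquiv (IsCMField.complexConj L) (Matrix.of fun i j : Fin 2 => if i.val + j.val + 1 = 2 then (1 : L) else 0) (IsCMField.complexConj_ne_one L) w hw) (γ₂) : ↥(unitaryGroupOfForm (galAdicCompletionMap (L := L) (IsCMField.complexConj L) hw) (placeForm (Matrix.of fun i j : Fin 2 => if i.val + j.val + 1 = 2 then (1 : L) else 0) w.1))) : GL (Fin 2) (w.1.adicCompletion L)) : Matrix (Fin 2) (Fin 2) (w.1.adicCompletion L))) - 1)).restrictScalars (Valued.integer (w.1.adicCompletion L))) ≤ UnitaryLatticeTree.scaleLattice ((ϖ : (w.1.adicCompletion L)) ^ 2) B)}.ncard = 0 := by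
  rw [ncard_selfDual_fixed_zero_eq_natCard_depthTwo L v w hw he h2 ϖ hϖ γ₂ h2deep,
    depthFixed_selfDual_top_eq_empty_of_even_depth_ramified L v w hw he h2 ϖ hϖ hσϖ γ₂ hirr (n := 1) le_rfl hN]
  simp

include hw in
/-- **W-SIDE ZERO COUNT, ODD DEPTH `2n+1`, `n ≥ 1`**: the W-side ZERO family has `m` elements with **`m + 1 = 2·Σ_(k<n) q^k`** (★ III
`natCard_depthFixed_selfDual_and_modular_of_odd_depth_ramified` at `j = 1`: an EDGE ball). [cite: LabesseLanglands1979, §2 Lemma 2.1 p. 8] [cite: Rogawski1990, §4.9 p. 56] [cite: Serre1980Trees, Ch. II §1.1] -/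
theorem ncard_selfDual_fixed_zero_of_odd_depth_ramified (he : v.asIdeal.ramificationIdx' w.1.asIdeal ≠ 1) (h2 : IsUnit (2 : 𝒪[(w.1.adicCompletion L)]))
    (ϖ : (w.1.adicCompletion L)ˣ) (hϖ : Valued.v (ϖ : (w.1.adicCompletion L)) = WithZero.exp (-1 : ℤ))
    (hσϖ : (galAdicCompletionMap (L := L) (IsCMField.complexConj L) hw) (ϖ : (w.1.adicCompletion L)) = -(ϖ : (w.1.adicCompletion L))) (γ₂ : ((cmDatum L 2 (Matrix.of fun i j : Fin 2 => if i.val + j.val + 1 = 2 then (1 : L) else 0)).Local v))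
    (hirr : ¬ ∃ x : (w.1.adicCompletion L), ((((((localNonsplitEquiv (IsCMField.complexConj L) (Matrix.of fun i j : Fin 2 => if i.val + j.val + 1 = 2 then (1 : L) else 0) (IsCMField.complexConj_ne_one L) w hw) (γ₂) : ↥(unitaryGroupOfForm (galAdicCompletionMap (L := L) (IsCMField.complexConj L) hw) (placeForm (Matrix.of fun i j : Fin 2 => if i.val + j.val + 1 = 2 then (1 : L) else 0) w.1))) : GL (Fin 2) (w.1.adicCompletion L)) : Matrix (Fin 2) (Fin 2) (w.1.adicCompletion L))).charpoly).IsRoot x)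
    (h2deep : ∀ i j : Fin 2, Valued.v ((((((localNonsplitEquiv (IsCMField.complexConj L) (Matrix.of fun i j : Fin 2 => if i.val + j.val + 1 = 2 then (1 : L) else 0) (IsCMField.complexConj_ne_one L) w hw) (γ₂) : ↥(unitaryGroupOfForm (galAdicCompletionMap (L := L) (IsCMField.complexConj L) hw) (placeForm (Matrix.of fun i j : Fin 2 => if i.val + j.val + 1 = 2 then (1 : L) else 0) w.1))) : GL (Fin 2) (w.1.adicCompletion L)) : Matrix (Fin 2) (Fin 2) (w.1.adicCompletion L)) - 1) i j) ≤ Valued.v ((ϖ : (w.1.adicCompletion L)) ^ 2))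
    {n : ℕ} (hn1 : 1 ≤ n) (hN : Valued.v ((((((localNonsplitEquiv (IsCMField.complexConj L) (Matrix.of fun i j : Fin 2 => if i.val + j.val + 1 = 2 then (1 : L) else 0) (IsCMField.complexConj_ne_one L) w hw) (γ₂) : ↥(unitaryGroupOfForm (galAdicCompletionMap (L := L) (IsCMField.complexConj L) hw) (placeForm (Matrix.of fun i j : Fin 2 => if i.val + j.val + 1 = 2 then (1 : L) else 0) w.1))) : GL (Fin 2) (w.1.adicCompletion L)) : Matrix (Fin 2) (Fin 2) (w.1.adicCompletion L))).trace ^ 2 - 4 * (((((localNonsplitEquiv (IsCMField.complexConj L) (Matrix.of fun i j : Fin 2 => if i.val + j.val + 1 = 2 then (1 : L) else 0) (IsCMField.complexConj_ne_one L) w hw) (γ₂) : ↥(unitaryGroupOfForm (galAdicCompletionMap (L := L) (IsCMField.complexConj L) hw) (placeForm (Matrix.of fun i j : Fin 2 => if i.val + j.val + 1 = 2 then (1 : L) else 0) w.1))) : GL (Fin 2) (w.1.adicCompletion L)) : Matrix (Fin 2) (Fin 2) (w.1.adicCompletion L))).det) = WithZero.exp (-((2 * (2 * n + 1) : ℕ)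 : ℤ))) :
    {B : Submodule (Valued.integer (w.1.adicCompletion L)) (Fin 2 → (w.1.adicCompletion L)) | UnitaryLatticeTree.IsSelfDualLattice (galAdicCompletionMap (L := L) (IsCMField.complexConj L) hw) (ϖ : (w.1.adicCompletion L)) (!![(0 : (w.1.adicCompletion L)), 1; 1, 0] : Matrix (Fin 2) (Fin 2) (w.1.adicCompletion L)) B ∧
        UnitaryLatticeTree.mapGL ((((localNonsplitEquiv (IsCMField.complexConj L) (Matrix.of fun i j : Fin 2 => if i.val + j.val + 1 = 2 then (1 : L) else 0) (IsCMField.complexConj_ne_one L) w hw) (γ₂) : ↥(unitaryGroupOfForm (galAdicCompletionMap (L := L) (IsCMField.complexConj L) hw) (placeForm (Matrix.of fun i j : Fin 2 => if i.val + j.val + 1 = 2 then (1 : L) else 0) w.1))) : GL (Fin 2) (w.1.adicCompletion L))) B = B ∧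
        (B.map ((Matrix.toLin' ((((((localNonsplitEquiv (IsCMField.complexConj L) (Matrix.of fun i j : Fin 2 => if i.val + j.val + 1 = 2 then (1 : L) else 0) (IsCMField.complexConj_ne_one L) w hw) (γ₂) : ↥(unitaryGroupOfForm (galAdicCompletionMap (L := L) (IsCMField.complexConj L) hw) (placeForm (Matrix.of fun i j : Fin 2 => if i.val + j.val + 1 = 2 then (1 : L) else 0) w.1))) : GL (Fin 2) (w.1.adicCompletion L)) : Matrix (Fin 2) (Fin 2) (w.1.adicCompletion L))) - 1)).restrictScalars (Valued.integer (w.1.adicCompletion L))) ≤ UnitaryLatticeTree.scaleLattice (ϖ : (w.1.adicCompletion L)) B ∧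
          B.map ((Matrix.toLin' ((((((localNonsplitEquiv (IsCMField.complexConj L) (Matrix.of fun i j : Fin 2 => if i.val + j.val + 1 = 2 then (1 : L) else 0) (IsCMField.complexConj_ne_one L) w hw) (γ₂) : ↥(unitaryGroupOfForm (galAdicCompletionMap (L := L) (IsCMField.complexConj L) hw) (placeForm (Matrix.of fun i j : Fin 2 => if i.val + j.val + 1 = 2 then (1 : L) else 0) w.1))) : GL (Fin 2) (w.1.adicCompletion L)) : Matrix (Fin 2) (Fin 2) (w.1.adicCompletion L))) - 1)).restrictScalars (Valued.integer (w.1.adicCompletion L))) ≤ UnitaryLatticeTree.scaleLattice ((ϖ : (w.1.adicCompletion L)) ^ 2) B)}.ncard + 1 =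
      2 * ∑ k ∈ Finset.range n, Nat.card (𝓞 ↥(maximalRealSubfield L) ⧸ v.asIdeal) ^ k := by
  obtain ⟨C', hC's⟩ := exists_subgroup_forall_mem_iff_sharp L v w hw (ϖ : (w.1.adicCompletion L)) hϖ
  obtain ⟨hC'c, hC'o⟩ := isCompact_and_isOpen_of_forall_mem_iff_sharp L v w hw (ϖ : (w.1.adicCompletion L)) hϖ C' hC's
  have hC' : ∀ g : ((cmDatum L 2 (Matrix.of fun i j : Fin 2 => if i.val + j.val + 1 = 2 then (1 : L) else 0)).Local v), g ∈ C' ↔ (((localNonsplitEquiv (IsCMField.complexConj L) (Matrix.of fun i j : Fin 2 => if i.val + j.val + 1 = 2 then (1 : L) else 0) (IsCMField.complexConj_ne_one L) w hw) (g) : ↥(unitaryGroupOfForm (galAdicCompletionMap (L := L) (IsCMField.complexConj L) hw) (placeForm (Matrix.of fun i j : Fin 2 => if i.val + j.val + 1 = 2 then (1 : L) else 0) w.1))) : GL (Fin 2) (w.1.adicCompletion L)) ∈ (glInt 2 (w.1.adicCompletion L)).map (MulAut.conj (glDiagonal 2 (w.1.adicCompletion L) ![1, ϖ])).toMonoidHom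 :=
    fun g => (hC's g).trans (forall_v_sharp_iff_coe_mem_map_conj L w hw ϖ ((localNonsplitEquiv (IsCMField.complexConj L) (Matrix.of fun i j : Fin 2 => if i.val + j.val + 1 = 2 then (1 : L) else 0) (IsCMField.complexConj_ne_one L) w hw) g))
  rw [ncard_selfDual_fixed_zero_eq_natCard_depthTwo L v w hw he h2 ϖ hϖ γ₂ h2deep]
  have h := (natCard_depthFixed_selfDual_and_modular_of_odd_depth_ramified L v w hw he h2 ϖ hϖ hσϖ C' hC' hC'o hC'c γ₂ hirr hN (j := 1) hn1).1
  rwa [Nat.sub_add_cancel hn1] at h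
end WSide

end Literature.NumberTheory.Automorphic.UnitaryGroup

end
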